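import Summits.HubbardSuperconductivity.HubbardSuperconductivity.Theorems.ThermalWedgeTwSeededEnsembleEquivalenceROptimiserFloor
import Summits.HubbardSuperconductivity.HubbardSuperconductivity.Theorems.ThermalWedgeTwSeededEnsembleEquivalenceRSourcedPressureLimit
import Summits.HubbardSuperconductivity.HubbardSuperconductivity.Theorems.ThermalWedgeTwSeededEnsembleEquivalenceRSharpSectorEntropy
import Summits.HubbardSuperconductivity.HubbardSuperconductivity.Theorems.ThermalWedgeTwApproximatingHamiltonian
import Summits.HubbardSuperconductivity.HubbardSuperconductivity.Theorems.ThermalWedgeTwSeededEnsembleEquivalenceRPbSectorSelection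
import Summits.HubbardSuperconductivity.HubbardSuperconductivity.Theorems.ThermalWedgeTwSeededEnsembleEquivalenceRSectorWeightLipschitz
import Summits.HubbardSuperconductivity.HubbardSuperconductivity.Theorems.ThermalWedgeTwSeededEnsembleEquivalenceRBlockProduct
import Summits.HubbardSuperconductivity.HubbardSuperconductivity.Theorems.ThermalWedgeTwSeededEnsembleEquivalenceRLogPartitionCalculus
import Summits.HubbardSuperconductivity.HubbardSuperconductivity.Theorems.ThermalWedgeTwSeededEnsembleEquivalenceRColdSlice
import Literature.MathematicalPhysics.QuantumLattice.DuhamelTwoPoint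
import Literature.MathematicalPhysics.QuantumLattice.DuhamelEqualTimeBounds
import Literature.MathematicalPhysics.QuantumLattice.GibbsLinearResponse

/-!
# Crux `TwSeededEnsembleEquivalenceR` (stmt-HubbardSuperconductivity-15581), line `cold-floor-collapse` (slug `Sketch`),
# skeleton v8 (block two-phase pinning) — registered stub `stub_blockDensityCalculus`

Support file (`--supports stmt-HubbardSuperconductivity-15581`; sorry-free; no definition).
Open-square block: density in [0, 2M²], chord inequalities of the convex log Z with derivative β·density (S5), response D ∈ [0, β²(2M²)²].
Proved for an arbitrary finite site set / graph / pair weights (`stub_blockDensityCalculusGeneric`, the registered twin: the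
verbatim `M × M` statement exceeds the 4000-character stub-signature cap of the work-item registry), then specialised verbatim
(`stub_blockDensityCalculus`, `Λ = Lex (Fin M × Fin M)`, `C = 2M²`).
-/

set_option linter.dupNamespace false

namespace Summit.HubbardSuperconductivity.HubbardSuperconductivity.Theorems.TwSeededEnsembleEquivalenceR.ColdFloorLine

open Matrix Filter Topology Finset Literature.MathematicalPhysics.QuantumLattice
open Literature.Barriers.HubbardSuperconductivity Literature.Probability.LatticeModels
open scoped ComplexOrder Matrix.Norms.L2Operator

noncomputable section

/-! ### Helper lemmas (private, prefixed `bdc_`) -/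

section Helpers

variable {Λ : Type} [LinearOrder Λ] [Fintype Λ]

/-- `‖N‖ ≤ 2|Λ|`: the total particle number is a sum of `2|Λ|` projections `n_{xσ}` of norm `≤ 1`. [folklore] -/
private theorem bdc_norm_totalNumber_le :
    ‖(totalNumber : Matrix (Finset (Orb Λ)) (Finset (Orb Λ)) ℂ)‖ ≤ 2 * (Fintype.card Λ : ℝ) := by
  -- adapted from `cfb_norm_totalNumber_le` (…RSourcedPressureBasics), torus ↦ arbitrary site set
  rw [totalNumber]
  refine (norm_sum_le _ _).trans ?_
  calc ∑ x : Λ, ‖∑ σ : Fin 2, (numberOp x σ : Matrix (Finset (Orb Λ)) _ ℂ)‖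
      ≤ ∑ _x : Λ, (2 : ℝ) := Finset.sum_le_sum fun x _ => by
        refine (norm_sum_le _ _).trans ?_
        calc ∑ σ : Fin 2, ‖(numberOp x σ : Matrix (Finset (Orb Λ)) _ ℂ)‖
            ≤ ∑ _σ : Fin 2, (1 : ℝ) := Finset.sum_le_sum fun σ _ => norm_numberOp_le_one x σ
          _ = 2 := by simp
    _ = 2 * (Fintype.card Λ : ℝ) := by
        rw [Finset.sum_const, Finset.card_univ, nsmul_eq_mul, mul_comm]

/-- `N ≥ 0`: the total particle number is diagonal with eigenvalues `#s ≥ 0`. [folklore] -/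
private theorem bdc_posSemidef_totalNumber :
    (totalNumber : Matrix (Finset (Orb Λ)) (Finset (Orb Λ)) ℂ).PosSemidef := by
  -- adapted from `posSemidef_totalNumber` (HubbardGrandCanonicalDensity)
  rw [totalNumber_eq_diagonal_card, posSemidef_diagonal_iff]
  exact fun s => Nat.cast_nonneg _

end Helpers

/-- **S7f, generic site set (registered twin `stub_blockDensityCalculusGeneric` of `stub_blockDensityCalculus`).** For the
pair-sourced grand-canonical Hubbard Hamiltonian `K(μ) = hamiltonianWith G t U μ − h(P_w + P_wᴴ) = T − μN` on an arbitrary finite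
site set `Λ` (any graph `G`, hopping `t`, pair weights `w`) and any `C ≥ 2|Λ|`: the density `Re⟨N⟩_{β,K(μ)}` lies in `[0, C]`
(`N ≥ 0`, `Re⟨N⟩ ≤ ‖N‖ ≤ 2|Λ|`); the chords of the convex `μ ↦ log Z_β(K(μ))`, whose derivative is `β Re⟨N⟩`
(S5 `stub_logPartitionCalculus` (i),(ii)), satisfy `s β n(μ) ≤ log Z(μ+s) − log Z(μ)` and `log Z(μ) − log Z(μ−s) ≤ s β n(μ)`
(`s ≥ 0`); and `μ ↦ β Re⟨N⟩` has a derivative `D ∈ [0, β² C²]` (S5 (iii): `D ≤ β² Var N ≤ β² Re⟨N²⟩ ≤ β² ‖N‖²`).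
The `M × M` open square of `stub_blockDensityCalculus` is the instance `Λ = Lex (Fin M × Fin M)`, `C = 2M²`. [folklore] -/
theorem stub_blockDensityCalculusGeneric :
    ∀ (Λ : Type) [LinearOrder Λ] [Fintype Λ] (G : SimpleGraph Λ) [DecidableRel G.Adj] (t U h : ℝ) (w : Λ × Λ → ℂ) (β : ℝ), 0 < β →
      ∀ (C : ℝ), 2 * (Fintype.card Λ : ℝ) ≤ C →
        (∀ μ : ℝ, 0 ≤ (Matrix.gibbsState β (hamiltonianWith G t U μ - (h : ℂ) • ((∑ z : Λ × Λ, w z • bondPair z.1 z.2) + (∑ z : Λ × Λ, w z • bondPair z.1 z.2)ᴴ)) (totalNumber : Matrix (Finset (Orb Λ)) (Finset (Orb Λ)) ℂ)).re ∧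
          (Matrix.gibbsState β (hamiltonianWith G t U μ - (h : ℂ) • ((∑ z : Λ × Λ, w z • bondPair z.1 z.2) + (∑ z : Λ × Λ, w z • bondPair z.1 z.2)ᴴ)) (totalNumber : Matrix (Finset (Orb Λ)) (Finset (Orb Λ)) ℂ)).re ≤ C) ∧
        (∀ μ s : ℝ, 0 ≤ s →
          s * (β * (Matrix.gibbsState β (hamiltonianWith G t U μ - (h : ℂ) • ((∑ z : Λ × Λ, w z • bondPair z.1 z.2) + (∑ z : Λ × Λ, w z • bondPair z.1 z.2)ᴴ)) (totalNumber : Matrix (Finset (Orb Λ)) (Finset (Orb Λ)) ℂ)).re) ≤ Real.log (Matrix.partitionFn β (hamiltonianWith G t U (μ + s) - (h : ℂ) • ((∑ z : Λ × Λ, w z • bondPair z.1 z.2) + (∑ z : Λ × Λ, w z • bondPair z.1 z.2)ᴴ))).re - Real.log (Matrix.partitionFn β (hamiltonianWith G t U μ - (h : ℂ) • ((∑ z : Λ × Λ, w z • bondPair z.1 z.2) + (∑ z : Λ × Λ, w z • bondPair z.1 z.2)ᴴ))).re ∧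
            Real.log (Matrix.partitionFn β (hamiltonianWith G t U μ - (h : ℂ) • ((∑ z : Λ × Λ, w z • bondPair z.1 z.2) + (∑ z : Λ × Λ, w z • bondPair z.1 z.2)ᴴ))).re - Real.log (Matrix.partitionFn β (hamiltonianWith G t U (μ - s) - (h : ℂ) • ((∑ z : Λ × Λ, w z • bondPair z.1 z.2) + (∑ z : Λ × Λ, w z • bondPair z.1 z.2)ᴴ))).re ≤ s * (β * (Matrix.gibbsState β (hamiltonianWith G t U μ - (h : ℂ) • ((∑ z : Λ × Λ, w z • bondPair z.1 z.2) + (∑ z : Λ × Λ, w z • bondPair z.1 z.2)ᴴ)) (totalNumber : Matrix (Finset (Orb Λ)) (Finset (Orb Λ)) ℂ)).re)) ∧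
        (∀ μ : ℝ, ∃ D : ℝ, HasDerivAt (fun μ' : ℝ => β * (Matrix.gibbsState β (hamiltonianWith G t U μ' - (h : ℂ) • ((∑ z : Λ × Λ, w z • bondPair z.1 z.2) + (∑ z : Λ × Λ, w z • bondPair z.1 z.2)ᴴ)) (totalNumber : Matrix (Finset (Orb Λ)) (Finset (Orb Λ)) ℂ)).re) D μ ∧ 0 ≤ D ∧ D ≤ β ^ 2 * C ^ 2) := by
  intro Λ _ _ G _ t U h w β hβ C hC
  -- the `μ`-independent part `T = H(t,U) − h(P + Pᴴ)` and the shift identity `K(μ) = T − μN`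
  obtain ⟨T, hT⟩ : ∃ T : Matrix (Finset (Orb Λ)) (Finset (Orb Λ)) ℂ,
      T = hamiltonian G t U - (h : ℂ) • ((∑ z : Λ × Λ, w z • bondPair z.1 z.2) + (∑ z : Λ × Λ, w z • bondPair z.1 z.2)ᴴ) := ⟨_, rfl⟩
  have hK : ∀ μ : ℝ, hamiltonianWith G t U μ - (h : ℂ) • ((∑ z : Λ × Λ, w z • bondPair z.1 z.2) + (∑ z : Λ × Λ, w z • bondPair z.1 z.2)ᴴ) =
      T - (μ : ℂ) • (totalNumber : Matrix (Finset (Orb Λ)) (Finset (Orb Λ)) ℂ) := fun μ => by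
    rw [hT, hamiltonianWith_eq, sub_right_comm]
  have hTh : T.IsHermitian := by
    have h0 := isHermitian_sourced G t U 0 h w
    rwa [hK 0, Complex.ofReal_zero, zero_smul, sub_zero] at h0
  have hNp : (totalNumber : Matrix (Finset (Orb Λ)) (Finset (Orb Λ)) ℂ).PosSemidef := bdc_posSemidef_totalNumber
  have hNh : (totalNumber : Matrix (Finset (Orb Λ)) (Finset (Orb Λ)) ℂ).IsHermitian := hNp.isHermitian
  have hKh : ∀ μ : ℝ, (T - (μ : ℂ) • (totalNumber : Matrix (Finset (Orb Λ)) (Finset (Orb Λ)) ℂ)).IsHermitian := fun μ =>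
    isHermitian_sub_smul hTh hNh μ
  -- `‖N‖ ≤ C`
  have hNC : ‖(totalNumber : Matrix (Finset (Orb Λ)) (Finset (Orb Λ)) ℂ)‖ ≤ C := bdc_norm_totalNumber_le.trans hC
  -- S5: derivative, convexity, response
  obtain ⟨hF, hconv, hD⟩ := stub_logPartitionCalculus (Finset (Orb Λ)) T totalNumber hTh hNh β hβ
  simp only [hK]
  refine ⟨fun μ => ⟨?_, ?_⟩, fun μ s hs => ?_, fun μ => ?_⟩
  · -- `0 ≤ Re⟨N⟩` since `N ≥ 0`
    exact (Complex.nonneg_iff.mp (gibbsState_nonneg_of_posSemidef β (hKh μ) hNp)).1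
  · -- `Re⟨N⟩ ≤ ‖N‖ ≤ C`
    exact (re_gibbsState_le_norm (hKh μ) β _).trans hNC
  · -- chords of the convex `log Z` with derivative `β Re⟨N⟩`
    rcases hs.eq_or_lt with rfl | hs'
    · rw [add_zero, sub_zero, sub_self, zero_mul]
      exact ⟨le_rfl, le_rfl⟩
    · have h1 := hconv.le_slope_of_hasDerivAt (Set.mem_univ μ) (Set.mem_univ (μ + s)) (by linarith) (hF μ)
      have h2 := hconv.slope_le_of_hasDerivAt (Set.mem_univ (μ - s)) (Set.mem_univ μ) (by linarith) (hF μ)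
      simp only [slope_def_field, add_sub_cancel_left, sub_sub_cancel] at h1 h2
      rw [le_div_iff₀ hs'] at h1
      rw [div_le_iff₀ hs'] at h2
      constructor <;> linarith
  · -- response: `0 ≤ D ≤ β² Var N ≤ β² Re⟨N²⟩ ≤ β² ‖N‖² ≤ β² C²`
    obtain ⟨D, hDd, hD0, hDle, -⟩ := hD μ
    refine ⟨D, hDd, hD0, hDle.trans (mul_le_mul_of_nonneg_left ?_ (sq_nonneg β))⟩
    have h1 := re_gibbsState_le_norm (hKh μ) β ((totalNumber : Matrix (Finset (Orb Λ)) (Finset (Orb Λ)) ℂ) * totalNumber)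
    have h2 := norm_mul_le (totalNumber : Matrix (Finset (Orb Λ)) (Finset (Orb Λ)) ℂ) totalNumber
    have h3 : ‖(totalNumber : Matrix (Finset (Orb Λ)) (Finset (Orb Λ)) ℂ)‖ * ‖(totalNumber : Matrix (Finset (Orb Λ)) (Finset (Orb Λ)) ℂ)‖ ≤ C * C :=
      mul_le_mul hNC hNC (norm_nonneg _) ((norm_nonneg _).trans hNC)
    nlinarith [sq_nonneg ((Matrix.gibbsState β (T - (μ : ℂ) • totalNumber) (totalNumber : Matrix (Finset (Orb Λ)) (Finset (Orb Λ)) ℂ)).re)]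

/-- **S7f `stub_blockDensityCalculus` (the open-square block: density, chords, response).** For the sourced `M × M`
open square `K_M(μ) = hamiltonianWith(…) 1 U μ − h(Δ_M + Δ_Mᴴ) = T_M − μ N_M` (`hamiltonianWith_eq`): the density
`n = Re⟨N_M⟩_{β,K_M(μ)}` lies in `[0, 2M²]` (`N_M ≥ 0`, `‖N_M‖ ≤ 2M²`); the chords of the convex `μ ↦ log Z_β(K_M(μ))` with
derivative `β n` (S5 `stub_logPartitionCalculus` (i),(ii)) satisfy `s β n(μ) ≤ log Z(μ+s) − log Z(μ)` and
`log Z(μ) − log Z(μ−s) ≤ s β n(μ)` (`s ≥ 0`); and `μ ↦ β n(μ)` has a derivative `D ∈ [0, β²(2M²)²]` (S5 (iii): `D ≤ β² Var N_M ≤ β²‖N_M‖²`).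
[folklore] -/
theorem stub_blockDensityCalculus :
    ∀ (M : ℕ), 1 ≤ M → ∀ (β U h : ℝ), 0 < β → 0 ≤ U →
      (∀ μ : ℝ, 0 ≤ (Matrix.gibbsState β (hamiltonianWith ((zdGraph 2).comap (fun p : (Lex (Fin M × Fin M)) => ![((ofLex p).1 : ℤ), ((ofLex p).2 : ℤ)])) 1 U μ - (h : ℂ) • ((∑ z : (Lex (Fin M × Fin M)) × (Lex (Fin M × Fin M)), (fun z : (Lex (Fin M × Fin M)) × (Lex (Fin M × Fin M)) => (fun v : Fin 2 → ℤ => ((dWaveFormFactor v / Real.sqrt 2 : ℝ) : ℂ)) (![((ofLex z.2).1 : ℤ), ((ofLex z.2).2 : ℤ)] - ![((ofLex z.1).1 : ℤ), ((ofLex z.1).2 : ℤ)])) z • bondPair z.1 z.2) + (∑ z : (Lex (Fin M × Fin M)) × (Lex (Fin M × Fin M)), (fun z : (Lex (Fin M × Fin M)) × (Lex (Fin M × Fin M)) => (fun v : Fin 2 → ℤ => ((dWaveFormFactor v / Real.sqrt 2 : ℝ) : ℂ)) (![((ofLex z.2).1 : ℤ), ((ofLex z.2).2 : ℤ)] - ![((ofLex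 z.1).1 : ℤ), ((ofLex z.1).2 : ℤ)])) z • bondPair z.1 z.2)ᴴ)) (totalNumber : Matrix (Finset (Orb (Lex (Fin M × Fin M)))) (Finset (Orb (Lex (Fin M × Fin M)))) ℂ)).re ∧
        (Matrix.gibbsState β (hamiltonianWith ((zdGraph 2).comap (fun p : (Lex (Fin M × Fin M)) => ![((ofLex p).1 : ℤ), ((ofLex p).2 : ℤ)])) 1 U μ - (h : ℂ) • ((∑ z : (Lex (Fin M × Fin M)) × (Lex (Fin M × Fin M)), (fun z : (Lex (Fin M × Fin M)) × (Lex (Fin M × Fin M)) => (fun v : Fin 2 → ℤ => ((dWaveFormFactor v / Real.sqrt 2 : ℝ) : ℂ)) (![((ofLex z.2).1 : ℤ), ((ofLex z.2).2 : ℤ)] - ![((ofLex z.1).1 : ℤ), ((ofLex z.1).2 : ℤ)])) z • bondPair z.1 z.2) + (∑ z : (Lex (Fin M × Fin M)) × (Lex (Fin M × Fin M)), (fun z : (Lex (Fin M × Fin M)) × (Lex (Fin M × Fin M)) => (fun v : Fin 2 → ℤ => ((dWaveFormFactor v / Real.sqrt 2 : ℝ) : ℂ)) (![((ofLex z.2).1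 : ℤ), ((ofLex z.2).2 : ℤ)] - ![((ofLex z.1).1 : ℤ), ((ofLex z.1).2 : ℤ)])) z • bondPair z.1 z.2)ᴴ)) (totalNumber : Matrix (Finset (Orb (Lex (Fin M × Fin M)))) (Finset (Orb (Lex (Fin M × Fin M)))) ℂ)).re ≤ 2 * (M : ℝ) ^ 2) ∧
      (∀ μ s : ℝ, 0 ≤ s →
        s * (β * (Matrix.gibbsState β (hamiltonianWith ((zdGraph 2).comap (fun p : (Lex (Fin M × Fin M)) => ![((ofLex p).1 : ℤ), ((ofLex p).2 : ℤ)])) 1 U μ - (h : ℂ) • ((∑ z : (Lex (Fin M × Fin M)) × (Lex (Fin M × Fin M)), (fun z : (Lex (Fin M × Fin M)) × (Lex (Fin M × Fin M)) => (fun v : Fin 2 → ℤ => ((dWaveFormFactor v / Real.sqrt 2 : ℝ) : ℂ)) (![((ofLex z.2).1 : ℤ), ((ofLex z.2).2 : ℤ)] - ![((ofLex z.1).1 : ℤ), ((ofLex z.1).2 : ℤ)])) z • bondPair z.1 z.2) + (∑ z : (Lex (Fin M × Fin M)) × (Lex (Fin M × Fin M)), (fun z : (Lex (Fin M × Fin M))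 × (Lex (Fin M × Fin M)) => (fun v : Fin 2 → ℤ => ((dWaveFormFactor v / Real.sqrt 2 : ℝ) : ℂ)) (![((ofLex z.2).1 : ℤ), ((ofLex z.2).2 : ℤ)] - ![((ofLex z.1).1 : ℤ), ((ofLex z.1).2 : ℤ)])) z • bondPair z.1 z.2)ᴴ)) (totalNumber : Matrix (Finset (Orb (Lex (Fin M × Fin M)))) (Finset (Orb (Lex (Fin M × Fin M)))) ℂ)).re) ≤ Real.log (Matrix.partitionFn β (hamiltonianWith ((zdGraph 2).comap (fun p : (Lex (Fin M × Fin M)) => ![((ofLex p).1 : ℤ), ((ofLex p).2 : ℤ)])) 1 U (μ + s) - (h : ℂ) • ((∑ z : (Lex (Fin M × Fin M)) × (Lex (Fin M × Fin M)), (fun z : (Lex (Fin M × Fin M)) × (Lex (Fin M × Fin M)) => (fun v : Fin 2 → ℤ => ((dWaveFormFactor v / Real.sqrt 2 : ℝ) : ℂ)) (![((ofLex z.2).1 : ℤ), ((ofLex z.2).2 : ℤ)] - ![((ofLex z.1).1 : ℤ), ((ofLex z.1).2 : ℤ)])) z • bondPair z.1 z.2) + (∑ z : (Lex (Fin M ×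 Fin M)) × (Lex (Fin M × Fin M)), (fun z : (Lex (Fin M × Fin M)) × (Lex (Fin M × Fin M)) => (fun v : Fin 2 → ℤ => ((dWaveFormFactor v / Real.sqrt 2 : ℝ) : ℂ)) (![((ofLex z.2).1 : ℤ), ((ofLex z.2).2 : ℤ)] - ![((ofLex z.1).1 : ℤ), ((ofLex z.1).2 : ℤ)])) z • bondPair z.1 z.2)ᴴ))).re - Real.log (Matrix.partitionFn β (hamiltonianWith ((zdGraph 2).comap (fun p : (Lex (Fin M × Fin M)) => ![((ofLex p).1 : ℤ), ((ofLex p).2 : ℤ)])) 1 U μ - (h : ℂ) • ((∑ z : (Lex (Fin M × Fin M)) × (Lex (Fin M × Fin M)), (fun z : (Lex (Fin M × Fin M)) × (Lex (Fin M × Fin M)) => (fun v : Fin 2 → ℤ => ((dWaveFormFactor v / Real.sqrt 2 : ℝ) : ℂ)) (![((ofLex z.2).1 : ℤ), ((ofLex z.2).2 : ℤ)] - ![((ofLex z.1).1 : ℤ), ((ofLex z.1).2 : ℤ)])) z • bondPair z.1 z.2) + (∑ z : (Lex (Fin M × Fin M)) × (Lex (Fin M × Fin M)), (fun z : (Lex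 (Fin M × Fin M)) × (Lex (Fin M × Fin M)) => (fun v : Fin 2 → ℤ => ((dWaveFormFactor v / Real.sqrt 2 : ℝ) : ℂ)) (![((ofLex z.2).1 : ℤ), ((ofLex z.2).2 : ℤ)] - ![((ofLex z.1).1 : ℤ), ((ofLex z.1).2 : ℤ)])) z • bondPair z.1 z.2)ᴴ))).re ∧
        Real.log (Matrix.partitionFn β (hamiltonianWith ((zdGraph 2).comap (fun p : (Lex (Fin M × Fin M)) => ![((ofLex p).1 : ℤ), ((ofLex p).2 : ℤ)])) 1 U μ - (h : ℂ) • ((∑ z : (Lex (Fin M × Fin M)) × (Lex (Fin M × Fin M)), (fun z : (Lex (Fin M × Fin M)) × (Lex (Fin M × Fin M)) => (fun v : Fin 2 → ℤ => ((dWaveFormFactor v / Real.sqrt 2 : ℝ) : ℂ)) (![((ofLex z.2).1 : ℤ), ((ofLex z.2).2 : ℤ)] - ![((ofLex z.1).1 : ℤ), ((ofLex z.1).2 : ℤ)])) z • bondPair z.1 z.2) + (∑ z : (Lex (Fin M × Fin M)) × (Lex (Fin M × Fin M)), (fun z : (Lex (Fin M × Fin M)) × (Lex (Fin M × Fin M))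 => (fun v : Fin 2 → ℤ => ((dWaveFormFactor v / Real.sqrt 2 : ℝ) : ℂ)) (![((ofLex z.2).1 : ℤ), ((ofLex z.2).2 : ℤ)] - ![((ofLex z.1).1 : ℤ), ((ofLex z.1).2 : ℤ)])) z • bondPair z.1 z.2)ᴴ))).re - Real.log (Matrix.partitionFn β (hamiltonianWith ((zdGraph 2).comap (fun p : (Lex (Fin M × Fin M)) => ![((ofLex p).1 : ℤ), ((ofLex p).2 : ℤ)])) 1 U (μ - s) - (h : ℂ) • ((∑ z : (Lex (Fin M × Fin M)) × (Lex (Fin M × Fin M)), (fun z : (Lex (Fin M × Fin M)) × (Lex (Fin M × Fin M)) => (fun v : Fin 2 → ℤ => ((dWaveFormFactor v / Real.sqrt 2 : ℝ) : ℂ)) (![((ofLex z.2).1 : ℤ), ((ofLex z.2).2 : ℤ)] - ![((ofLex z.1).1 : ℤ), ((ofLex z.1).2 : ℤ)])) z • bondPair z.1 z.2) + (∑ z : (Lex (Fin M × Fin M)) × (Lex (Fin M × Fin M)), (fun z : (Lex (Fin M × Fin M)) × (Lex (Fin M × Fin M)) => (fun v : Fin 2 → ℤ => ((dWaveFormFactor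 v / Real.sqrt 2 : ℝ) : ℂ)) (![((ofLex z.2).1 : ℤ), ((ofLex z.2).2 : ℤ)] - ![((ofLex z.1).1 : ℤ), ((ofLex z.1).2 : ℤ)])) z • bondPair z.1 z.2)ᴴ))).re ≤ s * (β * (Matrix.gibbsState β (hamiltonianWith ((zdGraph 2).comap (fun p : (Lex (Fin M × Fin M)) => ![((ofLex p).1 : ℤ), ((ofLex p).2 : ℤ)])) 1 U μ - (h : ℂ) • ((∑ z : (Lex (Fin M × Fin M)) × (Lex (Fin M × Fin M)), (fun z : (Lex (Fin M × Fin M)) × (Lex (Fin M × Fin M)) => (fun v : Fin 2 → ℤ => ((dWaveFormFactor v / Real.sqrt 2 : ℝ) : ℂ)) (![((ofLex z.2).1 : ℤ), ((ofLex z.2).2 : ℤ)] - ![((ofLex z.1).1 : ℤ), ((ofLex z.1).2 : ℤ)])) z • bondPair z.1 z.2) + (∑ z : (Lex (Fin M × Fin M)) × (Lex (Fin M × Fin M)), (fun z : (Lex (Fin M × Fin M)) × (Lex (Fin M × Fin M)) => (fun v : Fin 2 → ℤ => ((dWaveFormFactor v / Real.sqrt 2 : ℝ) : ℂ)) (![((ofLex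 z.2).1 : ℤ), ((ofLex z.2).2 : ℤ)] - ![((ofLex z.1).1 : ℤ), ((ofLex z.1).2 : ℤ)])) z • bondPair z.1 z.2)ᴴ)) (totalNumber : Matrix (Finset (Orb (Lex (Fin M × Fin M)))) (Finset (Orb (Lex (Fin M × Fin M)))) ℂ)).re)) ∧
      (∀ μ : ℝ, ∃ D : ℝ, HasDerivAt (fun μ' : ℝ => β * (Matrix.gibbsState β (hamiltonianWith ((zdGraph 2).comap (fun p : (Lex (Fin M × Fin M)) => ![((ofLex p).1 : ℤ), ((ofLex p).2 : ℤ)])) 1 U μ' - (h : ℂ) • ((∑ z : (Lex (Fin M × Fin M)) × (Lex (Fin M × Fin M)), (fun z : (Lex (Fin M × Fin M)) × (Lex (Fin M × Fin M)) => (fun v : Fin 2 → ℤ => ((dWaveFormFactor v / Real.sqrt 2 : ℝ) : ℂ)) (![((ofLex z.2).1 : ℤ), ((ofLex z.2).2 : ℤ)] - ![((ofLex z.1).1 : ℤ), ((ofLex z.1).2 : ℤ)])) z • bondPair z.1 z.2) + (∑ z : (Lex (Fin M × Fin M)) × (Lex (Fin M × Fin M)), (fun z : (Lex (Fin M × Fin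 M)) × (Lex (Fin M × Fin M)) => (fun v : Fin 2 → ℤ => ((dWaveFormFactor v / Real.sqrt 2 : ℝ) : ℂ)) (![((ofLex z.2).1 : ℤ), ((ofLex z.2).2 : ℤ)] - ![((ofLex z.1).1 : ℤ), ((ofLex z.1).2 : ℤ)])) z • bondPair z.1 z.2)ᴴ)) (totalNumber : Matrix (Finset (Orb (Lex (Fin M × Fin M)))) (Finset (Orb (Lex (Fin M × Fin M)))) ℂ)).re) D μ ∧ 0 ≤ D ∧ D ≤ β ^ 2 * (2 * (M : ℝ) ^ 2) ^ 2) := by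
  intro M _ β U h hβ _
  exact stub_blockDensityCalculusGeneric _ _ 1 U h _ β hβ (2 * (M : ℝ) ^ 2)
    (by rw [Fintype.card_lex, Fintype.card_prod, Fintype.card_fin]; push_cast; nlinarith)

end

end Summit.HubbardSuperconductivity.HubbardSuperconductivity.Theorems.TwSeededEnsembleEquivalenceR.ColdFloorLine
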